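import Summits.HodgeConjecture.HodgeConjecture.Theorems.NoetherLefschetzOneUpVerticalHodgeAlgebraic
import Literature.AlgebraicGeometry.HodgeTheory.SaitoGrFDeRhamCurveNetHolds
import Literature.AlgebraicGeometry.HodgeTheory.HodgeRiemannPolarizabilityProofs
import Literature.AlgebraicGeometry.HodgeTheory.LefschetzOneOneHolds
import HarnessLib

/-!
# `stub_verticalHodgeAlgebraic` — VERTICAL HODGE CLASSES ON A NETTED FOURFOLD ARE ALGEBRAIC

Registered stub `stub_verticalHodgeAlgebraic` of line `birth` of crux `FourfoldsGrantedK3Nets`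
(stmt-HodgeConjecture-14599, route `NoetherLefschetzOneUp` of `HodgeConjecture`). Its statement is,
BY NAME, the route's support item `VerticalHodgeAlgebraic` (stmt-HodgeConjecture-11603): for `X`
smooth projective of dimension `4` over `ℂ` and `f : X ⟶ ℙ²` surjective on points, the span of the
rational `(2,2)`-classes `c ∈ H⁴(X(ℂ); ℂ)` vanishing on `(X ∖ f⁻¹T)(ℂ)` for some Zariski-closed
`T ⊊ ℙ²` (the VERTICAL classes of the net) lies in `algebraicClasses X 2`.

PROOF. The tree's conditional theorem `Theorems.verticalHodgeAlgebraic_of`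
(`Theorems/NoetherLefschetzOneUpVerticalHodgeAlgebraic.lean`: vertical classes are supported in
codimension `≥ 1`, and rational `(2,2)`-classes in `N¹H⁴` of a smooth projective fourfold are
algebraic by C. Voisin 2013, proof of Lemma 2.1 — Deligne's description of
`ker (H⁴(X) → H⁴(X ∖ Z))` as a sum of Gysin images of resolutions of the components of `Z`, lifting
of Hodge classes along it by semisimplicity of polarisable Hodge structures, Lefschetz `(1,1)` on the
resolved threefolds / surfaces, and algebraicity of Gysin images of algebraic classes) takes three
named facts of the tree as hypotheses, all three of which are now THEOREMS of the Literature layer: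

* `Deligne1974_ker_restrictCompl_eq_iSup_range_complexGysin_holds` (Deligne, *Hodge III*,
  Cor. 8.2.8; `HodgeTheory/SaitoGrFDeRhamCurveNetHolds.lean`, from Prop. 8.2.7 proved through log
  resolution and the `∂∂̄`-lemma);
* `Voisin2025_hodgeClass_lift_complexGysin_holds` (Voisin 2025, Cor. 2.12;
  `HodgeTheory/HodgeRiemannPolarizabilityProofs.lean`, from the polarizability of the Hodge
  structures of smooth projective varieties);
* `lefschetzOneOne_rational_holds` (Voisin I, Thm. 11.30 in rational form;
  `HodgeTheory/LefschetzOneOneHolds.lean`, via Kodaira–Serre and GAGA).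

Feeding them in proves the item unconditionally. No named fact, no `sorry`.

## References

* [DeligneHodgeIII1974] P. Deligne, *Théorie de Hodge III*, Publ. Math. IHÉS 44 (1974), Cor. 8.2.8.
* [Voisin2025] C. Voisin, Cor. 2.12 (lifting Hodge classes along sums of Gysin morphisms).
* [VoisinHodgeI2002] C. Voisin, *Hodge Theory and Complex Algebraic Geometry I* (2002), Thm. 11.30.
* [Voisin2013GHCBloch] C. Voisin, Ann. Sci. ÉNS 46 (2013), Lemma 2.1 (proof).
-/

-- `Summit.HodgeConjecture.HodgeConjecture.Theorems` is the mandated namespace (single-problem summit),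
-- flagged by `linter.dupNamespace`; the lakefile turns the linter off tree-wide, restated here.
set_option linter.dupNamespace false

noncomputable section

open Literature.AlgebraicGeometry.HodgeTheory

namespace Summit.HodgeConjecture.HodgeConjecture.Theorems

/-- **`VerticalHodgeAlgebraic` (route item stmt-HodgeConjecture-11603), unconditionally** — stub
`stub_verticalHodgeAlgebraic` of line `birth` of crux `FourfoldsGrantedK3Nets`: for `f : X ⟶ ℙ²`
surjective on a smooth projective complex fourfold `X`, the span of the rational `(2,2)`-classes
vanishing on `X ∖ f⁻¹T` for some Zariski-closed `T ⊊ ℙ²` lies in `algebraicClasses X 2`. Proof: the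
conditional theorem `verticalHodgeAlgebraic_of` (Voisin 2013, proof of Lemma 2.1 with `k = 2`) fed
with the tree's discharges of its three named-fact hypotheses — Deligne's *Hodge III* Cor. 8.2.8
(`Deligne1974_ker_restrictCompl_eq_iSup_range_complexGysin_holds`), the lifting of Hodge classes
along sums of Gysin morphisms (`Voisin2025_hodgeClass_lift_complexGysin_holds`) and Lefschetz's
theorem on `(1,1)`-classes in rational form (`lefschetzOneOne_rational_holds`).
[cite: DeligneHodgeIII1974, Cor. 8.2.8] [cite: Voisin2025, Cor. 2.12]
[cite: VoisinHodgeI2002, Thm. 11.30] [cite: Voisin2013GHCBloch, Lemma 2.1 (proof)] -/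
theorem stub_verticalHodgeAlgebraic :
    Summit.HodgeConjecture.HodgeConjecture.Theses.NoetherLefschetzOneUp.VerticalHodgeAlgebraic :=
  verticalHodgeAlgebraic_of Deligne1974_ker_restrictCompl_eq_iSup_range_complexGysin_holds
    Voisin2025_hodgeClass_lift_complexGysin_holds lefschetzOneOne_rational_holds

end Summit.HodgeConjecture.HodgeConjecture.Theorems

end
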